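import Mathlib
import HarnessLib
import Literature.NumberTheory.Automorphic.UnitaryCoherentGaloisRep
import Literature.NumberTheory.Automorphic.MokWeakBaseChange
import Literature.NumberTheory.Automorphic.AutomorphicRepsGLSatakeFlathProofs

/-!
# Stub `stub_almostAllUnramified` of line `Sketch` (card `hecke-algebra-valued-limit`) for the crux
`Summit.Langlands.Langlands.Theses.QuadraticWindow.GaloisRepOfUnitaryLDS` (stmt-Langlands-15129)

For a cuspidal automorphic representation datum `σ` of Mok's quasi-split unitary group
`U_{K/F₀}(N)` and a prime `ℓ`, the set of finite places `u` of `K` which are NOT good — good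
meaning: `u ∤ ℓ`, and every place `u'` of `K` over the same rational prime as `u` is unramified
over `ℚ` (`e(u' | ℤ) = 1`) with `σ` unramified at `u'` (`UnitaryGroup.IsUnramifiedAt`: a
base-change Satake parameter exists) — is finite.

The three inputs:
* (a) only finitely many places divide `ℓ` (`Ideal.finite_factors`);
* (b) only finitely many places of `K` are ramified over `ℚ` (the prime factors of the absolute
  different `𝔇_{K/ℚ} ≠ 0`, Mathlib `differentIdeal_ne_bot`, `not_dvd_differentIdeal_iff`,
  `Ideal.ramificationIdx_eq_one_of_isUnramifiedAt`), and the fibres of `u ↦ u ∩ ℤ` are finite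
  (`tendsto_under_cofinite`), so a cofinite property of places holds at ALL places over the same
  rational prime for cofinitely many places;
* (c) `σ` is unramified at all but finitely many places.  For `N = 0` this is proved outright
  (`U(0)` is the trivial group: every form is spherical with the empty parameter).  For `0 < N`
  it is Flath's theorem for `U_{K/F₀}(N)` together with the unramified base change on Satake
  parameters; in the tree it is obtained from Mok's weak base change (the named fact
  `Mok2014_weakBaseChange`, Mok 2015 Cor. 4.3.8, taken as a hypothesis: at almost every `w` the
  base-change Satake parameters of `σ` are exactly the Satake parameters of an automorphic
  representation datum `P` of `GL_N(𝔸_K)`) and the PROVED Flath theorem for `GL_N`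
  (`AutomorphicRepData.hasSatakeParamAt_cofinite_holds`: `P` has a Satake parameter at almost
  every place).  Mok's theorem is stated for `[K : F₀] = 2` and `cK ≠ 1`, whence these two
  hypotheses (available in the crux) in the corrected signature.
-/

set_option linter.dupNamespace false

noncomputable section

open scoped NumberField Polynomial Classical
open Polynomial IsDedekindDomain NumberField Filter
open Literature.NumberTheory.Automorphic Literature.NumberTheory.GaloisRepresentations

namespace Summit.Langlands.Langlands.Theorems.GaloisRepOfUnitaryLDS.HeckeAlgebraValuedLimit

/-! ## (a), (b): places over `ℓ` and places ramified over `ℚ` -/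

section Places

variable (K : Type) [Field K] [NumberField K]

/-- (a) Only finitely many finite places of `K` lie over the rational prime `ℓ` (the prime factors
of the non-zero ideal `(ℓ)`, `Ideal.finite_factors`). [folklore] -/
theorem finite_setOf_natCast_mem (ℓ : ℕ) [Fact ℓ.Prime] :
    {u : HeightOneSpectrum (𝓞 K) | ((ℓ : ℕ) : 𝓞 K) ∈ u.asIdeal}.Finite := by
  have hI : (Ideal.span {((ℓ : ℕ) : 𝓞 K)} : Ideal (𝓞 K)) ≠ ⊥ := by
    rw [Ne, Ideal.span_singleton_eq_bot]
    exact_mod_cast (Fact.out : ℓ.Prime).ne_zero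
  refine (Ideal.finite_factors hI).subset fun v hv => ?_
  exact Ideal.dvd_iff_le.mpr ((Ideal.span_singleton_le_iff_mem _).mpr hv)

/-- (b) All but finitely many finite places of `K` are unramified over `ℚ`: `e(u | u ∩ ℤ) = 1` for
every `u` not dividing the absolute different `𝔇_{K/ℚ} ≠ 0` (Mathlib `differentIdeal_ne_bot`,
`not_dvd_differentIdeal_iff`, `Ideal.ramificationIdx_eq_one_of_isUnramifiedAt`,
`Ideal.finite_factors`). [folklore] -/
theorem eventually_ramificationIdx_int_eq_one :
    ∀ᶠ u : HeightOneSpectrum (𝓞 K) in cofinite, u.asIdeal.ramificationIdx ℤ = 1 := by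
  have h0 : differentIdeal ℤ (𝓞 K) ≠ ⊥ := differentIdeal_ne_bot
  refine (Ideal.finite_factors h0).subset fun u hu => ?_
  by_contra hnd
  apply hu
  haveI := u.isPrime
  haveI : Algebra.IsUnramifiedAt ℤ u.asIdeal := not_dvd_differentIdeal_iff.mp hnd
  exact Ideal.ramificationIdx_eq_one_of_isUnramifiedAt

/-- Fibre transfer along `u ↦ u ∩ ℤ`: a property holding at all but finitely many places of `K`
holds, for all but finitely many places `u`, at EVERY place `u'` over the same rational prime as
`u` (the bad places are finitely many, so are the rational primes below them, and `u ↦ u ∩ ℤ` has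
finite fibres, `tendsto_under_cofinite`). [folklore] -/
theorem eventually_forall_under_eq {P : HeightOneSpectrum (𝓞 K) → Prop}
    (h : ∀ᶠ u in cofinite, P u) :
    ∀ᶠ u : HeightOneSpectrum (𝓞 K) in cofinite,
      ∀ u' : HeightOneSpectrum (𝓞 K), u'.asIdeal.under ℤ = u.asIdeal.under ℤ → P u' := by
  have hB : {u' : HeightOneSpectrum (𝓞 K) | ¬ P u'}.Finite := Filter.eventually_cofinite.mp h
  have hT := (hB.image fun u' : HeightOneSpectrum (𝓞 K) => u'.under ℤ).compl_mem_cofinite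
  filter_upwards [(tendsto_under_cofinite (B := 𝓞 K) ℤ).eventually hT] with u hu u' hu'
  by_contra hP
  exact hu ⟨u', hP, HeightOneSpectrum.ext hu'⟩

end Places

/-! ## (c): `σ` is unramified almost everywhere -/

section Automorphic

variable (F E : Type) [Field F] [NumberField F] [Field E] [NumberField E] [Algebra F E]
  (c : E ≃ₐ[F] E)

/-- The adelic points of `U_{E/F}(0)` form a trivial group (`GL_0` is trivial). [folklore] -/
theorem subsingleton_adelic_rank_zero : Subsingleton (UnitaryGroup.quasiSplit F E c 0).Adelic :=
  ⟨fun _ _ => UnitaryGroup.adelicVal_injective F E c 0 _ (Subsingleton.elim _ _)⟩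

/-- (c), rank `0`: every automorphic representation datum of the trivial group `U_{E/F}(0)` is
unramified at every finite place, with the empty base-change Satake parameter: any
`φ ∈ W ∖ W'` is fixed by everything, the only Hecke operator is `[K 1 K] = 1`, and the unramified
eigenvalue `λ_β([K 1 K])` is the single Iwasawa value `1` (empty product). [folklore] -/
theorem isUnramifiedAt_rank_zero (hcpt : isCompact_glFiniteIntegralLevel 0 E)
    (π : AutomorphicRepData (UnitaryGroup.quasiSplitDatum F E c 0 hcpt))
    (w : HeightOneSpectrum (𝓞 E)) : UnitaryGroup.IsUnramifiedAt F E c 0 hcpt π w := by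
  haveI := subsingleton_adelic_rank_zero F E c
  obtain ⟨φ, hφW, hφW'⟩ := Set.exists_of_ssubset π.lt
  have hndvd : ∀ u : HeightOneSpectrum (𝓞 E), ¬ u.asIdeal ∣ (⊤ : Ideal (𝓞 E)) := fun u hu =>
    u.isPrime.ne_top (top_le_iff.mp (Ideal.dvd_iff_le.mp hu))
  have hfix : ∀ u : (UnitaryGroup.quasiSplit F E c 0).Adelic,
      rightTranslation (UnitaryGroup.quasiSplit F E c 0) u φ = φ := fun u => by
    funext g
    rw [rightTranslation_apply, Subsingleton.elim (g * u) g]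
  refine ⟨_, ⊤, Fin.elim0, ?_, hndvd w, hndvd (c • w), ⟨fun i => i.elim0, fun _ i => i.elim0⟩,
    rfl, φ, hφW, hφW', fun u _ => hfix u, fun t _ => ?_⟩
  · exact fun h => top_ne_bot (h.trans Submodule.zero_eq_bot)
  · -- the Hecke operator `[K t K] = [K 1 K]` is the identity on the `K`-fixed `φ`
    set L := UnitaryGroup.level F E c 0 (⊤ : Ideal (𝓞 E)) with hL
    have ht : t = 1 := Subsingleton.elim _ _
    have hφfix : φ ∈ (rightTranslation (UnitaryGroup.quasiSplit F E c 0)).fixedPoints L :=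
      (Representation.mem_fixedPoints _ L φ).2 fun g _ => hfix g
    have hop : heckeOperator (rightTranslation (UnitaryGroup.quasiSplit F E c 0)) L t φ = φ := by
      rw [ht]; exact heckeOperator_one_apply _ L hφfix
    -- the unramified eigenvalue is `1`
    have horb : MulAction.orbit L ((t : (UnitaryGroup.quasiSplit F E c 0).Adelic ⧸ L)) =
        {((t : (UnitaryGroup.quasiSplit F E c 0).Adelic) : (UnitaryGroup.quasiSplit F E c 0).Adelic ⧸ L)} := by
      ext y
      obtain ⟨g, rfl⟩ := QuotientGroup.mk_surjective y
      rw [Subsingleton.elim g t]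
      simp only [Set.mem_singleton_iff, iff_true]
      exact MulAction.mem_orbit_self _
    have hsupp : UnitaryGroup.IsSupportedAt F E c 0 w t :=
      ⟨Subsingleton.elim _ _, fun u _ _ => Subsingleton.elim _ _⟩
    have hupper : UnitaryGroup.IsUpperTriangularAt F E c 0 w t := fun i => i.elim0
    have hev : UnitaryGroup.heckeEigenvalue F E c 0 w Fin.elim0 L t = 1 := by
      rw [UnitaryGroup.heckeEigenvalue, horb, finsum_mem_singleton, UnitaryGroup.iwasawaValue,
        dif_pos ⟨t, hsupp, hupper, rfl⟩, UnitaryGroup.iwasawaChar]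
      exact Finset.prod_of_isEmpty _
    rw [hop, hev, one_smul, sub_self]
    exact zero_mem _

variable {F E c} in
/-- (c) **`σ` is unramified at all but finitely many places** (`[E : F] = 2`, `c ≠ 1`): for
`N = 0` by `isUnramifiedAt_rank_zero`; for `0 < N`, Mok's weak base change `P` of `σ` to
`GL_N(𝔸_E)` (hypothesis `Mok2014_weakBaseChange`, Mok 2015 Cor. 4.3.8: at almost every `w` the
base-change Satake parameters of `σ` at `w` are exactly the Satake parameters of `P` at `w`) has a
Satake parameter at almost every place (Flath's theorem for `GL_N`, proved in the tree:
`AutomorphicRepData.hasSatakeParamAt_cofinite_holds`). [folklore] -/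
theorem eventually_isUnramifiedAt (hMok : Mok2014_weakBaseChange) (h2 : Module.finrank F E = 2)
    (hc : c ≠ 1) (N : ℕ) (hcpt : isCompact_glFiniteIntegralLevel N E)
    (π : UnitaryGroup.CuspidalAutomorphicRepData F E c N hcpt) :
    ∀ᶠ w : HeightOneSpectrum (𝓞 E) in cofinite, UnitaryGroup.IsUnramifiedAt F E c N hcpt π.1 w := by
  rcases Nat.eq_zero_or_pos N with rfl | hN
  · exact Filter.Eventually.of_forall fun w => isUnramifiedAt_rank_zero F E c hcpt π.1 w
  · obtain ⟨P, -, hP⟩ := hMok F E c h2 hc N hcpt π hN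
    filter_upwards [hP, P.hasSatakeParamAt_cofinite_holds] with w hw hPw
    obtain ⟨α, hα⟩ := hPw
    exact ⟨α, (hw α).mpr hα⟩

end Automorphic

/-! ## The stub -/

/-- **Stub `stub_almostAllUnramified` (P3 of line `Sketch`)**, conditional on Mok's weak base
change and with the two hypotheses `[K : F₀] = 2`, `cK ≠ 1` of that theorem (both available in
the crux): for `σ` cuspidal on `U_{K/F₀}(N)` and a prime `ℓ`, the set of places `u` of `K` which
are not good — good: `u ∤ ℓ` and every place `u'` of `K` over the same rational prime is
unramified over `ℚ` with `σ` unramified at `u'` — is finite.  Assembly of (a)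
`finite_setOf_natCast_mem`, (b) `eventually_ramificationIdx_int_eq_one` with the fibre transfer
`eventually_forall_under_eq`, and (c) `eventually_isUnramifiedAt`. -/
theorem stub_almostAllUnramified : Mok2014_weakBaseChange →
    ∀ (F₀ K : Type) [Field F₀] [NumberField F₀] [Field K] [NumberField K] [Algebra F₀ K]
      (cK : K ≃ₐ[F₀] K), Module.finrank F₀ K = 2 → cK ≠ 1 → ∀ (N : ℕ) (ℓ : ℕ) [Fact ℓ.Prime]
      (hcptK : isCompact_glFiniteIntegralLevel N K)
      (σ : UnitaryGroup.CuspidalAutomorphicRepData F₀ K cK N hcptK),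
      {u : HeightOneSpectrum (𝓞 K) | ¬ (((ℓ : ℕ) : 𝓞 K) ∉ u.asIdeal ∧
        ∀ u' : HeightOneSpectrum (𝓞 K), u'.asIdeal.under ℤ = u.asIdeal.under ℤ →
          u'.asIdeal.ramificationIdx ℤ = 1 ∧
            UnitaryGroup.IsUnramifiedAt F₀ K cK N hcptK σ.1 u')}.Finite := by
  intro hMok F₀ K _ _ _ _ _ cK h2 hc N ℓ _ hcptK σ
  have hgood := eventually_forall_under_eq K
    ((eventually_ramificationIdx_int_eq_one K).and (eventually_isUnramifiedAt hMok h2 hc N hcptK σ))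
  refine Filter.eventually_cofinite.mp ?_
  filter_upwards [(finite_setOf_natCast_mem K ℓ).compl_mem_cofinite, hgood] with u hu hu'
  exact ⟨hu, hu'⟩

end Summit.Langlands.Langlands.Theorems.GaloisRepOfUnitaryLDS.HeckeAlgebraValuedLimit

end
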